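import Literature.AnabelianGeometry.EtaleTheta.Discharge.Sec4MuSaturatedOfRatFnTorsion
import Literature.AnabelianGeometry.EtaleTheta.Discharge.Sec4CoprimePullThetaTwistTower
import Literature.AnabelianGeometry.EtaleTheta.Discharge.Sec3Cor38ThetaTwistTower
import Literature.AnabelianGeometry.EtaleTheta.Discharge.Sec4Prop42SubRootLawTreeVocabWeak
import HarnessLib

/-!
# [EtTh] Prop. 4.2 (iii) AS TYPED at the FOURTH tower model of record (the tempered Frobenioid of the ε-free theta tower over
# `B^temp(Compat₃′)⁰`), reduced to LEVEL-WISE `μ_N`-saturation: deep Galois coverings with `μ`-trivialising stabilisers, the root law in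
# binder shape, and the END-KNIT of (iii) [and of (iii) ∧ (iv) at the roots reading]

S. Mochizuki, *The étale theta function and its Frobenioid-theoretic manifestations*, Publ. RIMS **45** (2009) [MochizukiEtTh2009], §1 p.13
(«`K_N := K(ζ_N, q_X^{1/N})`»), Def. 3.3 (ii)(iii) p.73, Def. 4.1 (ii)(iv) p.86–87, Prop. 4.2 (iii)(iv) PDF p.88–90 (proof p.89 l.77 –
p.90 l.25) [cite: MochizukiEtTh2009, Prop 4.2 (iii) p.88]; [FrdI] Thm. 5.2 (i)(ii) p.100–101; [FrdII] Def. 2.1 (i) p.16, Rmk. 2.2.1 p.18;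
[SemiAnbd] Rmk. 3.1.3 p.33 (Galois domination in `B^temp(Π)`).

abc-iut cell, layer L2 [EtTh], DAG node `EtTh:Prop4.2(iii)` (abc-iut-L2-lead R1035: «instance cell = NONE YET»; first positive carrier =
abc-iut-L2-d2's fourth model `ThetaTwistTowerTempered.temperedFrobenioid R S`, p493549); seat abc-iut-w6-d037 (gen 6), row
«P42III-POSITIVE@FOURTH-MODEL» steps S2/S3.  PROOF-ONLY (0 `def`s, 0 instances; nothing landed is edited or restated).  Consumed BY NAME:
abc-iut-L2-t3's `quotCoverC₃` / `le_lvlC_quotCoverC₃` / `stabC₃` / `kumLevelC₃` / `ofMulAction_quot_fix_iff₃` / `lvlC_le_of_hom`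
(`…ThetaTwistTowerRootLaw`, FILE 4), `ConnectedPart.exists_hom_from_isGaloisObj` (`Sec4GaloisLiftBTemp`), abc-iut-L1-t6's `isTemperedC` /
`continuous_coordC` / `toAdd_left_mul` (`Compat 3 thetaShear`), abc-iut-L2-d2's `hP`, `baseRootLaw_galois` (p495818; A10 p493728, E2 (a)
p490708), abc-iut-w6-d037's `coprimePullLaw` (p496921) and `isMuSaturated_…` bridge (p496075), abc-iut-w4-d044's
`Prop42Sub.prop42_iii_mkOfModelCanonical_of_laws` / `prop42_iii_iv_mkOfModelCanonical_rootsReading` (p428253 / p428987),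
`RealifiedDivisorMonoids.pow_injective_ΦR_gp_treeVocabWeak`, L1's `ModelFrobenioid.mkHom` / `isPullbackMorphism_of`.
* §0 generic: `TemperedFrobenioid.exists_isPullbackMorphism_over_baseHom` — the pull-back morphism `(1, b, 0, 1)` over a base arrow.
* §1 **`exists_galoisCover_level_charTrivial Y m`** — every connected tempered `Compat₃′`-covering `Y` is dominated by a GALOIS `Y′ → Y` of
  level `≥ m` all of whose stabilisers have trivial cyclotomic-character coordinate `χ_m` (so «GRP₃′» acts trivially on `μ_{N_m}` along
  `Y′`): `Compat₃′/(Stab(y₀) ∩ kumLevelC₃ m ∩ Ker χ_m)` (open, countable index) dominated by a Galois object (`Compat₃′` tempered); `χ_m` is a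
  homomorphism to the ABELIAN `(ℤ/M_m)ˣ`, so its triviality passes to conjugate stabilisers.  (`closureC m` itself is NOT open —
  abc-iut-L2-d2's finding F-L2d2g7-2 — hence the open `Ker χ_m`.)
* §2 `rootLaw_galois` — the E2 root law `hR` in the `B`-side binder shape of the law-level closers with `IG := «Galois»`, NO hypothesis.
* §3–§4 **`prop42_iii_of_levelSaturation[']`** — [EtTh] Prop. 4.2 (iii) AS TYPED at the canonical §4 model over the fourth tower model
  (trivial `(N,H)`-slot; DISPLAYED Def. 4.1 (ii) Galois datum `(gS, gSs, hS)` for a free tempered arithmetic group `X`, any Frobenius-trivial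
  Galois-based anchor `A_⊙`) ⟸ ONE level-wise law `hsat`: «beyond a threshold `m = m(K)`, every object with `χ_m`-trivial stabilisers is
  `μ_K`-saturated» — the deliverable (M3) of abc-iut-L2-d2's «MU-TORSION@FOURTH-MODEL» (`Sec4MuTorsionThetaTwistTower`, in flight) —
  EVERY other input a theorem here: `Φ` divisorial, `hDSpull` (p496921), `hR` (§3), `hE` (`refinementLaw_of_levelSaturation[']` = §1 + §0);
  **`prop42_iii_iv_rootsReading_of_levelSaturationKummer`** — (iii) ∧ (iv) at the roots reading ⟸ the level-wise CYCLOTOMIC–KUMMER law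
  `hsatK` (saturation AND `K`-th roots of `A_⊙`'s `Div_B`-trivial rational functions over the deep covering: print's `K_N = K(ζ_N, …)`).
HONEST FRAMING: a class-(b) combinatorial design carrier (NOT the tempered Frobenioid of a Tate curve); the (β) deviation of record (torsion
sign of Prop. 1.4 (ii) not carried) stands; the Galois datum of Def. 4.1 (ii) is DISPLAYED, not constructed (abc-iut-L2-t3's (J3a)
quotient-base setting will supply it); [EtTh]/[FrdI]/[FrdII]/[SemiAnbd] are refereed prerequisite papers; nothing here bears on, or takes a
side on, the disputed [IUTchIII] Cor. 3.12; nothing here asserts abc proved or refuted.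
-/

noncomputable section

namespace Literature.AnabelianGeometry.EtaleTheta

open CategoryTheory Opposite Function Literature.AlgebraicGeometry.Frobenioids Literature.AnabelianGeometry.SemiGraphs
  Literature.AlgebraicGeometry.Frobenioids.QuasiTemperoid LogDivisorModel LogDivisorModel.GaloisAction LogDivisorTower

/-! ## §0 Generic: the pull-back morphism `(1, b, 0, 1)` over a base arrow ([FrdI] Thm. 5.2 (i)) -/

namespace TemperedFrobenioid

universe u₀ v₀ u v w

variable {D₀ : Type u₀} [Category.{v₀} D₀] {V : FrdIMonoidStub.{w}} {T : RealifiedDivisorMonoids (D₀ := D₀) V}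
  {D : Type u} [Category.{v} D] {VD : FrdICatStub.{u, v, w} D} (C : TemperedFrobenioid T D VD)

/-- **Over every base arrow `b : Y′ → A′^bs` there is a pull-back morphism `(1, b, 0, 1) : (Y′, b^*[A′]) → A′`** of the tempered
Frobenioid ([FrdI] Thm. 5.2 (i) model; `Φ` divisorial, `B` group-like). [cite: MochizukiFrdI2008, Thm. 5.2(i) p.100] -/
theorem exists_isPullbackMorphism_over_baseHom (hΦd : Objectwise (fun M _ => IsDivisorial M) C.divisorMonoid)
    (A' : C.category) {Y' : D} (b : Y' ⟶ A'.base) :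
    ∃ (W : C.category) (δ : W ⟶ A'), W.base = Y' ∧ PreFrobenioid.IsPullbackMorphism C.toElem δ :=
  ⟨⟨Y', pullGp C.divisorMonoid b A'.cls⟩,
    ModelFrobenioid.mkHom _ A' 1 b 1 1 (by rw [PNat.one_coe, pow_one, map_one, mul_one, map_one, mul_one]), rfl,
    ModelFrobenioid.isPullbackMorphism_of hΦd (C.isGroupLike_ratFnFunctor T.isUnit_BΛ) rfl rfl⟩

end TemperedFrobenioid

namespace ThetaTwistTowerTempered

open LogDivisorModel.TateTowerThetaTwist TateTowerKummerTwistRShear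
open TateTowerKummerTwist (M Cst N)

/-! ## §1 Every Galois covering is dominated by a Galois covering of level `≥ m` whose stabilisers have trivial character
coordinate `m` -/

/-- **Deep Galois coverings with `μ`-trivialising stabilisers**: every connected tempered `Compat₃′`-covering `Y` is dominated by a
GALOIS covering `Y′ → Y` of level `≥ m` every stabiliser of which has trivial cyclotomic-character coordinate of index `m` (so
«GRP₃′» acts trivially on `μ_{N_m}` along `Y′`): dominate `Y` by `Compat₃′/(Stab(y₀) ∩ kumLevelC₃ m ∩ Ker χ_m)` (open, countable index;
pattern of abc-iut-L2-t3's `rootLawC₃sf` covering), then by a Galois object ([SemiAnbd] Rmk. 3.1.3 — `Compat₃′` is tempered,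
abc-iut-L1-t6's `isTemperedC`); the character coordinate is a homomorphism to the ABELIAN group `(ℤ/M_m)ˣ`, so its triviality passes
to conjugate stabilisers. [cite: MochizukiEtTh2009, Def 3.3 (ii) p.73] -/
theorem exists_galoisCover_level_charTrivial (Y : ConnectedPart (BTemp (Compat 3 thetaShear))) (m : ℕ) :
    ∃ (Y' : ConnectedPart (BTemp (Compat 3 thetaShear))) (_ : IsGaloisObj Y'.obj) (_ : Y' ⟶ Y),
      m ≤ lvlC 3 thetaShear Y' ∧
        ∀ (s : Y'.obj.obj.V) (g : Compat 3 thetaShear), Y'.obj.obj.ρ g s = s → (g : Grp 3 thetaShear).right.1 m = 1 := by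
  obtain ⟨y₀⟩ := BTempConnected.nonempty_of_isConnectedObj Y.obj Y.property
  -- the character coordinate of index `m` as a homomorphism on the compatible group
  let χm : Compat 3 thetaShear →* (ZMod (M m))ˣ :=
    ((Pi.evalMonoidHom (fun n : ℕ => (ZMod (M n))ˣ) m).comp (MonoidHom.fst Cst (Multiplicative ℤ))).comp
      (SemidirectProduct.rightHom.comp (compat 3 thetaShear).subtype)
  have hχm : ∀ g : Compat 3 thetaShear, χm g = (g : Grp 3 thetaShear).right.1 m := fun _ => rfl
  have hχm_cont : Continuous χm :=
    (TateTowerKummerTwistRShear.continuous_coordC 3 thetaShear m).comp continuous_subtype_val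
  -- the open subgroup `H := Stab(y₀) ∩ kumLevelC₃ m ∩ Ker χ_m` of countable index
  let H : Subgroup (Compat 3 thetaShear) := stabC₃ Y.obj y₀ ⊓ kumLevelC₃ m ⊓ χm.ker
  have hH : IsOpen (H : Set (Compat 3 thetaShear)) :=
    ((isOpen_stabC₃ Y.obj y₀).inter (isOpen_kumLevelC₃ m)).inter ((isOpen_discrete {(1 : (ZMod (M m))ˣ)}).preimage hχm_cont)
  have hc : Countable (Compat 3 thetaShear ⧸ H) := by
    haveI : Countable Y.obj.obj.V := Y.obj.property.1
    haveI : ∀ i : Fin m, NeZero (M (i : ℕ)) := fun i => ⟨(Nat.factorial_pos _).ne'⟩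
    let F : Compat 3 thetaShear → Y.obj.obj.V × (∀ i : Fin m, Fin 3 → ZMod (M i)) × (ZMod (M m))ˣ :=
      fun g => (Y.obj.obj.ρ g y₀, fun i => Multiplicative.toAdd (g : Grp 3 thetaShear).left i, χm g)
    have hF : ∀ a b : Compat 3 thetaShear, a⁻¹ * b ∈ H → F a = F b := by
      intro a b hab
      obtain ⟨⟨h1, h2⟩, h3⟩ := hab
      have hb : b = a * (a⁻¹ * b) := by rw [mul_inv_cancel_left]
      refine Prod.ext ?_ (Prod.ext (funext fun i => ?_) ?_)
      · change Y.obj.obj.ρ a y₀ = Y.obj.obj.ρ b y₀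
        rw [hb, BTempConnected.ρ_mul_apply]
        exact (congrArg _ h1).symm
      · change Multiplicative.toAdd (a : Grp 3 thetaShear).left i = Multiplicative.toAdd (b : Grp 3 thetaShear).left i
        rw [hb, Subgroup.coe_mul, TateTowerKummerTwistRShear.toAdd_left_mul, h2 i i.2, Matrix.mulVec_zero, smul_zero, add_zero]
      · change χm a = χm b
        have h3' : χm (a⁻¹ * b) = 1 := h3
        rw [map_mul, map_inv, inv_mul_eq_one] at h3'
        exact h3'
    refine Function.Injective.countable (f := fun q : Compat 3 thetaShear ⧸ H => Quotient.liftOn' q F fun a b hab =>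
      hF a b (QuotientGroup.leftRel_apply.1 hab)) fun q₁ q₂ hq => ?_
    induction q₁ using QuotientGroup.induction_on with
    | H a =>
      induction q₂ using QuotientGroup.induction_on with
      | H b =>
        change F a = F b at hq
        obtain ⟨h1, h23⟩ := Prod.ext_iff.1 hq
        obtain ⟨h2, h3⟩ := Prod.ext_iff.1 h23
        refine QuotientGroup.eq.2 ⟨⟨?_, fun i hi => ?_⟩, ?_⟩
        · change Y.obj.obj.ρ (a⁻¹ * b) y₀ = y₀
          rw [BTempConnected.ρ_mul_apply]
          exact (congrArg _ h1.symm).trans (BTempConnected.ρ_inv_apply Y.obj a y₀)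
        · have h2i := congrFun h2 ⟨i, hi⟩
          change Multiplicative.toAdd (a : Grp 3 thetaShear).left i = Multiplicative.toAdd (b : Grp 3 thetaShear).left i at h2i
          rw [Subgroup.coe_mul, Subgroup.coe_inv, TateTowerKummerTwistRShear.toAdd_left_mul, TateTowerKummerTwistRShear.toAdd_left_inv,
            SemidirectProduct.inv_right, Prod.fst_inv, Prod.snd_inv, Pi.inv_apply, ← h2i, ← smul_add, ← Matrix.mulVec_add,
            neg_add_cancel, Matrix.mulVec_zero, smul_zero]
        · change χm (a⁻¹ * b) = 1
          rw [map_mul, map_inv, inv_mul_eq_one]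
          exact h3
  -- the covering `Y₁ := Compat₃′/H → Y`, `[g] ↦ g · y₀`
  let Y₁ : ConnectedPart (BTemp (Compat 3 thetaShear)) := quotCoverC₃ H hH hc
  obtain ⟨f₀, -⟩ := BTempConnected.exists_hom_of_stabilizer_le (T₁ := Y₁.obj) (T₂ := Y.obj)
    ((1 : Compat 3 thetaShear) : Compat 3 thetaShear ⧸ H)
    (fun q => by
      induction q using QuotientGroup.induction_on with
      | H g => exact ⟨g, by
          change (Action.ofMulAction (Compat 3 thetaShear) (Compat 3 thetaShear ⧸ H)).ρ g _ = _
          rw [Action.ofMulAction_apply, MulAction.Quotient.smul_coe, smul_eq_mul, mul_one]⟩)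
    y₀ (fun g hg => by
      have h1 := (ofMulAction_quot_fix_iff₃ H 1 g).1 hg
      rw [inv_one, one_mul, mul_one] at h1
      exact h1.1.1)
  let f₁ : Y₁ ⟶ Y := ObjectProperty.homMk f₀
  -- the level of `Y₁` is at least `m`
  have hm₁ : m ≤ lvlC 3 thetaShear Y₁ := le_lvlC_quotCoverC₃ H hH hc fun g hg => hg.1.2
  -- dominate `Y₁` by a Galois object
  obtain ⟨Y', hY', ⟨g₁⟩⟩ := ConnectedPart.exists_hom_from_isGaloisObj (isTemperedC 3 thetaShear) Y₁
  refine ⟨Y', hY', g₁ ≫ f₁, hm₁.trans (lvlC_le_of_hom 3 thetaShear g₁), fun s g hgs => ?_⟩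
  -- stabilisers of `Y′` map into stabilisers of `Y₁ = Compat₃′/H`, i.e. into conjugates of `H ⊆ Ker χ_m`
  have hq : Y₁.obj.obj.ρ g (g₁.hom.hom.hom s) = g₁.hom.hom.hom s := by
    rw [← BTempConnected.hom_ρ g₁.hom g s, hgs]
  obtain ⟨k, hk⟩ : ∃ k : Compat 3 thetaShear, (k : Compat 3 thetaShear ⧸ H) = g₁.hom.hom.hom s :=
    Quot.exists_rep (g₁.hom.hom.hom s)
  rw [← hk] at hq
  have hmem : k⁻¹ * g * k ∈ H := (ofMulAction_quot_fix_iff₃ H k g).1 hq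
  have h3 : (χm k)⁻¹ * χm g * χm k = 1 := by
    rw [← map_inv, ← map_mul, ← map_mul]
    exact hmem.2
  rw [mul_comm, ← mul_assoc, mul_inv_cancel, one_mul] at h3
  rw [← hχm g]
  exact h3


variable (R S : ((ConnectedPart (BTemp (Compat 3 thetaShear)))ᵒᵖ ⥤ CommMonCat.{0}) → Prop)

/-! ## §2 The root law in binder shape and the §4 model's slots at the fourth model -/

/-- The monoid type of the fourth model is `ℤ`. [cite: MochizukiEtTh2009, Def 3.6 p.77] -/
theorem monoidType_eq : (ThetaTwistTowerTempered.temperedFrobenioid R S).monoidType = MonoidType.Z := rfl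

/-- **The tempered-meromorphic root law `hR` (ERRATUM E2, G-w4d044-3) in the `B`-side binder shape of the Prop. 4.2 (iii) law-level
closers, with `IG := «Galois»`, at the fourth model — NO hypothesis** (A10 `baseRootLaw_galois` p495818/p493728 + `Φ` perfect + `hTF` at
the weak vocabulary). [cite: MochizukiEtTh2009, Prop 4.2 (iii) p.89] -/
theorem rootLaw_galois (N : ℕ+) (A : ConnectedPart (BTemp (Compat 3 thetaShear)))
    (hA : IsGaloisObj ((ThetaTwistTowerTempered.temperedFrobenioid R S).base.obj A).obj)
    (f : (ThetaTwistTowerTempered.temperedFrobenioid R S).ratFnFunctor.obj (op A)) :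
    ∃ (A' : ConnectedPart (BTemp (Compat 3 thetaShear)))
      (_ : IsGaloisObj ((ThetaTwistTowerTempered.temperedFrobenioid R S).base.obj A').obj) (c : A' ⟶ A)
      (g : (ThetaTwistTowerTempered.temperedFrobenioid R S).ratFnFunctor.obj (op A')),
      g ^ (N : ℕ) = pull (ThetaTwistTowerTempered.temperedFrobenioid R S).ratFnFunctor c f :=
  (ThetaTwistTowerTempered.temperedFrobenioid R S).rootLaw_of_baseRootLaw' _ (hP R S)
    (fun _ _ hN => RealifiedDivisorMonoids.pow_injective_ΦR_gp_treeVocabWeak _ _ hN) (baseRootLaw_galois R S) N A hA f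

variable {K : Type 1} [Field K] (X : SemiGraphs.TemperedArithmeticGroup.{1} K)
  (gS : ∀ A : ConnectedPart (BTemp (Compat 3 thetaShear)),
    IsGaloisObj ((ThetaTwistTowerTempered.temperedFrobenioid R S).base.obj A).obj → (X.Pi →* Aut A))
  (gSs : ∀ (A : ConnectedPart (BTemp (Compat 3 thetaShear)))
    (h : IsGaloisObj ((ThetaTwistTowerTempered.temperedFrobenioid R S).base.obj A).obj), Function.Surjective (gS A h))
  (A₀ : (ThetaTwistTowerTempered.temperedFrobenioid R S).category)
  (hA₀ : PreFrobenioid.IsFrobeniusTrivial (ThetaTwistTowerTempered.temperedFrobenioid R S).toElem A₀)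
  (hA₀' : IsGaloisObj ((ThetaTwistTowerTempered.temperedFrobenioid R S).base.obj A₀.base).obj)

/-- **[EtTh] Prop. 4.2 (iii) at the fourth model from the `B`-side cyclotomic covering law `hμ₀` alone** (abc-iut-w6-d037's
`prop42_iii_mkOfModelCanonical_trivNH_of_cyclotomicLaw`, p496075, with `Φ` divisorial / `hDSpull` / `hR` discharged here), plus the
displayed Galois datum. [cite: MochizukiEtTh2009, Prop 4.2 (iii) p.88] -/
theorem prop42_iii_of_cyclotomicLaw
    (hμ₀ : ∀ (N : ℕ+) (Y : ConnectedPart (BTemp (Compat 3 thetaShear))),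
      IsGaloisObj ((ThetaTwistTowerTempered.temperedFrobenioid R S).base.obj Y).obj →
      ∃ (Y' : ConnectedPart (BTemp (Compat 3 thetaShear)))
        (_ : IsGaloisObj ((ThetaTwistTowerTempered.temperedFrobenioid R S).base.obj Y').obj) (_ : Y' ⟶ Y),
      ∃ ζ : ((ThetaTwistTowerTempered.temperedFrobenioid R S).ratFnFunctor.obj (op Y'))ˣ,
        Literature.AlgebraicGeometry.Frobenioids.divB (ThetaTwistTowerTempered.temperedFrobenioid R S).divisorMonoid
            (ThetaTwistTowerTempered.temperedFrobenioid R S).ratFnFunctor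
            (ThetaTwistTowerTempered.temperedFrobenioid R S).divBNatTrans (op Y')
            (ζ : (ThetaTwistTowerTempered.temperedFrobenioid R S).ratFnFunctor.obj (op Y')) = 1 ∧
          orderOf ζ = (N : ℕ) ∧
          ∀ u : ((ThetaTwistTowerTempered.temperedFrobenioid R S).ratFnFunctor.obj (op Y'))ˣ,
            Literature.AlgebraicGeometry.Frobenioids.divB (ThetaTwistTowerTempered.temperedFrobenioid R S).divisorMonoid
                (ThetaTwistTowerTempered.temperedFrobenioid R S).ratFnFunctor
                (ThetaTwistTowerTempered.temperedFrobenioid R S).divBNatTrans (op Y')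
                (u : (ThetaTwistTowerTempered.temperedFrobenioid R S).ratFnFunctor.obj (op Y')) = 1 →
              u ^ (N : ℕ) = 1 → u ∈ Subgroup.zpowers ζ)
    (hS : ∀ ⦃A B : ConnectedPart (BTemp (Compat 3 thetaShear))⦄
      (hA : IsGaloisObj ((ThetaTwistTowerTempered.temperedFrobenioid R S).base.obj A).obj)
      (hB : IsGaloisObj ((ThetaTwistTowerTempered.temperedFrobenioid R S).base.obj B).obj) (b : B ⟶ A),
      ∃ c : X.Pi, ∀ g : X.Pi, (gS B hB g).hom ≫ b = b ≫ (gS A hA (c * g * c⁻¹)).hom) :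
    (BiKummerSetting.mkOfModelCanonical X (ThetaTwistTowerTempered.temperedFrobenioid R S) (monoidType_eq R S) (hP R S)
        (fun A => IsGaloisObj ((ThetaTwistTowerTempered.temperedFrobenioid R S).base.obj A).obj) gS gSs
        (fun _ _ _ => True) A₀ hA₀ hA₀').Prop42_iii
      (fun {_ _} φ x => (ThetaTwistTowerTempered.temperedFrobenioid R S).pullFracModel φ x) :=
  BiKummerSetting.Prop42Sub.prop42_iii_mkOfModelCanonical_trivNH_of_cyclotomicLaw X
    (ThetaTwistTowerTempered.temperedFrobenioid R S) (monoidType_eq R S) (hP R S) _ gS gSs A₀ hA₀ hA₀'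
    (ThetaTwistTowerTempered.temperedFrobenioid R S).isDivisorial_divisorMonoid
    (fun e _ _ hab y hya hyb => ThetaTwistTowerTempered.coprimePullLaw R S e hab y hya hyb)
    (rootLaw_galois R S) hμ₀ hS


/-! ## §3 The refinement law `hE` and Prop. 4.2 (iii) at the fourth model from LEVEL-WISE `μ_N`-saturation (abc-iut-L2-d2's
«MU-TORSION@FOURTH-MODEL» (M3) is the intended producer of `hsat`) -/

/-- **`hE` ([FrdII] Rmk. 2.2.1, GAP G-w4d044-2 at the trivial slot) at the fourth model from level-wise `μ_N`-saturation**: if every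
object over a covering of level `≥ m` with `χ_m`-trivial stabilisers is `μ_K`-saturated for `K ∣ N_m`, then every object with Galois
base has a `μ_K`-saturated Galois-based pull-back refinement (§1 with `m := K`, `K ∣ (K+1)! = N_K`; the pull-back morphism
`(1, b, 0, 1)` of [FrdI] Thm. 5.2 (i)). [cite: MochizukiEtTh2009, Prop 4.2 (iii) p.90] -/
theorem refinementLaw_of_levelSaturation
    (hsat : ∀ (K : ℕ+) (m : ℕ) (A : (ThetaTwistTowerTempered.temperedFrobenioid R S).category), (K : ℕ) ∣ (N m : ℕ) →
      m ≤ lvlC 3 thetaShear A.base →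
      (∀ (s : A.base.obj.obj.V) (g : Compat 3 thetaShear), A.base.obj.obj.ρ g s = s → (g : Grp 3 thetaShear).right.1 m = 1) →
        (ThetaTwistTowerTempered.temperedFrobenioid R S).IsMuSaturated A K) :
    ∀ (K : ℕ+) (A' : (ThetaTwistTowerTempered.temperedFrobenioid R S).category),
      PreFrobenioid.IsFrobeniusTrivial (ThetaTwistTowerTempered.temperedFrobenioid R S).toElem A' →
      IsGaloisObj ((ThetaTwistTowerTempered.temperedFrobenioid R S).base.obj A'.base).obj →
      ∃ (A'' : (ThetaTwistTowerTempered.temperedFrobenioid R S).category) (ψ : A'' ⟶ A'),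
        PreFrobenioid.IsPullbackMorphism (ThetaTwistTowerTempered.temperedFrobenioid R S).toElem ψ ∧
        IsGaloisObj ((ThetaTwistTowerTempered.temperedFrobenioid R S).base.obj A''.base).obj ∧
        (ThetaTwistTowerTempered.temperedFrobenioid R S).IsMuSaturated A'' K ∧ True := by
  intro K A' _ _
  obtain ⟨Y', hY', b, hm, hχ⟩ := exists_galoisCover_level_charTrivial A'.base K
  obtain ⟨W, δ, hW, hδ⟩ := (ThetaTwistTowerTempered.temperedFrobenioid R S).exists_isPullbackMorphism_over_baseHom
    (ThetaTwistTowerTempered.temperedFrobenioid R S).isDivisorial_divisorMonoid A' b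
  subst hW
  exact ⟨W, δ, hδ, hY', hsat K K W (Nat.dvd_factorial K.pos (Nat.le_succ _)) hm hχ, trivial⟩

/-- **[EtTh] Prop. 4.2 (iii) AS TYPED, POSITIVE at the fourth tower model of record** (canonical §4 model over
`ThetaTwistTowerTempered.temperedFrobenioid R S`, trivial `(N,H)`-slot, DISPLAYED Galois datum `(gS, gSs, hS)` of Def. 4.1 (ii) for a
free tempered arithmetic group `X`, any Frobenius-trivial Galois-based anchor `A_⊙`) ⟸ level-wise `μ_N`-saturation `hsat`
(abc-iut-L2-d2's «MU-TORSION@FOURTH-MODEL») — every other input a THEOREM at this carrier: `Φ` divisorial (Def. 3.6 (ii) field),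
`hDSpull` (abc-iut-w6-d037 p496921), the root law `hR` (A10 p495818/p493728, E2 (a) p490708), the refinement law `hE` (§4 + §1).
[cite: MochizukiEtTh2009, Prop 4.2 (iii) p.88] -/
theorem prop42_iii_of_levelSaturation
    (hsat : ∀ (K : ℕ+) (m : ℕ) (A : (ThetaTwistTowerTempered.temperedFrobenioid R S).category), (K : ℕ) ∣ (N m : ℕ) →
      m ≤ lvlC 3 thetaShear A.base →
      (∀ (s : A.base.obj.obj.V) (g : Compat 3 thetaShear), A.base.obj.obj.ρ g s = s → (g : Grp 3 thetaShear).right.1 m = 1) →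
        (ThetaTwistTowerTempered.temperedFrobenioid R S).IsMuSaturated A K)
    (hS : ∀ ⦃A B : ConnectedPart (BTemp (Compat 3 thetaShear))⦄
      (hA : IsGaloisObj ((ThetaTwistTowerTempered.temperedFrobenioid R S).base.obj A).obj)
      (hB : IsGaloisObj ((ThetaTwistTowerTempered.temperedFrobenioid R S).base.obj B).obj) (b : B ⟶ A),
      ∃ c : X.Pi, ∀ g : X.Pi, (gS B hB g).hom ≫ b = b ≫ (gS A hA (c * g * c⁻¹)).hom) :
    (BiKummerSetting.mkOfModelCanonical X (ThetaTwistTowerTempered.temperedFrobenioid R S) (monoidType_eq R S) (hP R S)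
        (fun A => IsGaloisObj ((ThetaTwistTowerTempered.temperedFrobenioid R S).base.obj A).obj) gS gSs
        (fun _ _ _ => True) A₀ hA₀ hA₀').Prop42_iii
      (fun {_ _} φ x => (ThetaTwistTowerTempered.temperedFrobenioid R S).pullFracModel φ x) :=
  BiKummerSetting.Prop42Sub.prop42_iii_mkOfModelCanonical_of_laws X (ThetaTwistTowerTempered.temperedFrobenioid R S)
    (monoidType_eq R S) (hP R S) _ gS gSs _ A₀ hA₀ hA₀'
    (ThetaTwistTowerTempered.temperedFrobenioid R S).isDivisorial_divisorMonoid
    (fun e _ _ hab y hya hyb => ThetaTwistTowerTempered.coprimePullLaw R S e hab y hya hyb)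
    (rootLaw_galois R S) (refinementLaw_of_levelSaturation R S hsat) hS


/-! ## §4 The same with the level threshold chosen by the producer (`∃ m`), and the ROOTS READING (iii) ∧ (iv) -/

/-- **`hE` at the fourth model from level-wise saturation with a producer-chosen threshold**: if for every `K` there is a
level threshold `m` beyond which every object with `χ_m`-trivial stabilisers is `μ_K`-saturated, then the refinement law holds (§1 at
that `m`). [cite: MochizukiEtTh2009, Prop 4.2 (iii) p.90] -/
theorem refinementLaw_of_levelSaturation'
    (hsat : ∀ K : ℕ+, ∃ m : ℕ, ∀ A : (ThetaTwistTowerTempered.temperedFrobenioid R S).category,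
      m ≤ lvlC 3 thetaShear A.base →
      (∀ (s : A.base.obj.obj.V) (g : Compat 3 thetaShear), A.base.obj.obj.ρ g s = s → (g : Grp 3 thetaShear).right.1 m = 1) →
        (ThetaTwistTowerTempered.temperedFrobenioid R S).IsMuSaturated A K) :
    ∀ (K : ℕ+) (A' : (ThetaTwistTowerTempered.temperedFrobenioid R S).category),
      PreFrobenioid.IsFrobeniusTrivial (ThetaTwistTowerTempered.temperedFrobenioid R S).toElem A' →
      IsGaloisObj ((ThetaTwistTowerTempered.temperedFrobenioid R S).base.obj A'.base).obj →
      ∃ (A'' : (ThetaTwistTowerTempered.temperedFrobenioid R S).category) (ψ : A'' ⟶ A'),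
        PreFrobenioid.IsPullbackMorphism (ThetaTwistTowerTempered.temperedFrobenioid R S).toElem ψ ∧
        IsGaloisObj ((ThetaTwistTowerTempered.temperedFrobenioid R S).base.obj A''.base).obj ∧
        (ThetaTwistTowerTempered.temperedFrobenioid R S).IsMuSaturated A'' K ∧ True := by
  intro K A' _ _
  obtain ⟨m, hm⟩ := hsat K
  obtain ⟨Y', hY', b, hmY, hχ⟩ := exists_galoisCover_level_charTrivial A'.base m
  obtain ⟨W, δ, hW, hδ⟩ := (ThetaTwistTowerTempered.temperedFrobenioid R S).exists_isPullbackMorphism_over_baseHom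
    (ThetaTwistTowerTempered.temperedFrobenioid R S).isDivisorial_divisorMonoid A' b
  subst hW
  exact ⟨W, δ, hδ, hY', hm W hmY hχ, trivial⟩

/-- **[EtTh] Prop. 4.2 (iii) AS TYPED, POSITIVE at the fourth model, producer-chosen threshold form.**
[cite: MochizukiEtTh2009, Prop 4.2 (iii) p.88] -/
theorem prop42_iii_of_levelSaturation'
    (hsat : ∀ K : ℕ+, ∃ m : ℕ, ∀ A : (ThetaTwistTowerTempered.temperedFrobenioid R S).category,
      m ≤ lvlC 3 thetaShear A.base →
      (∀ (s : A.base.obj.obj.V) (g : Compat 3 thetaShear), A.base.obj.obj.ρ g s = s → (g : Grp 3 thetaShear).right.1 m = 1) →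
        (ThetaTwistTowerTempered.temperedFrobenioid R S).IsMuSaturated A K)
    (hS : ∀ ⦃A B : ConnectedPart (BTemp (Compat 3 thetaShear))⦄
      (hA : IsGaloisObj ((ThetaTwistTowerTempered.temperedFrobenioid R S).base.obj A).obj)
      (hB : IsGaloisObj ((ThetaTwistTowerTempered.temperedFrobenioid R S).base.obj B).obj) (b : B ⟶ A),
      ∃ c : X.Pi, ∀ g : X.Pi, (gS B hB g).hom ≫ b = b ≫ (gS A hA (c * g * c⁻¹)).hom) :
    (BiKummerSetting.mkOfModelCanonical X (ThetaTwistTowerTempered.temperedFrobenioid R S) (monoidType_eq R S) (hP R S)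
        (fun A => IsGaloisObj ((ThetaTwistTowerTempered.temperedFrobenioid R S).base.obj A).obj) gS gSs
        (fun _ _ _ => True) A₀ hA₀ hA₀').Prop42_iii
      (fun {_ _} φ x => (ThetaTwistTowerTempered.temperedFrobenioid R S).pullFracModel φ x) :=
  BiKummerSetting.Prop42Sub.prop42_iii_mkOfModelCanonical_of_laws X (ThetaTwistTowerTempered.temperedFrobenioid R S)
    (monoidType_eq R S) (hP R S) _ gS gSs _ A₀ hA₀ hA₀'
    (ThetaTwistTowerTempered.temperedFrobenioid R S).isDivisorial_divisorMonoid
    (fun e _ _ hab y hya hyb => ThetaTwistTowerTempered.coprimePullLaw R S e hab y hya hyb)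
    (rootLaw_galois R S) (refinementLaw_of_levelSaturation' R S hsat) hS

set_option maxHeartbeats 400000 in
/-- **[EtTh] Prop. 4.2 (iii) ∧ (iv) AS TYPED at the fourth model AT THE ROOTS READING of the `(N, H_⊙^{bs-fld})`-slot** ⟸ the
level-wise CYCLOTOMIC–KUMMER saturation `hsatK`: beyond a producer-chosen threshold `m = m(K)`, every object `A` with `χ_m`-trivial
stabilisers is `μ_K`-saturated AND every `Div_B`-trivial rational function of `A_⊙` becomes a `K`-th power in `B(A^bs)` along every base
arrow (print's `K_N = K(ζ_N, …)`; [FrdII] Rmk. 2.2.1's `K(μ_N, (O_K^×)^{1/N})`) — with the displayed Galois datum; every other input a theorem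
here (abc-iut-w4-d044's `prop42_iii_iv_mkOfModelCanonical_rootsReading` p428987 as the frame). [cite: MochizukiEtTh2009, Prop 4.2 p.88] -/
theorem prop42_iii_iv_rootsReading_of_levelSaturationKummer
    (hsatK : ∀ K : ℕ+, ∃ m : ℕ, ∀ A : (ThetaTwistTowerTempered.temperedFrobenioid R S).category,
      m ≤ lvlC 3 thetaShear A.base →
      (∀ (s : A.base.obj.obj.V) (g : Compat 3 thetaShear), A.base.obj.obj.ρ g s = s → (g : Grp 3 thetaShear).right.1 m = 1) →
        (ThetaTwistTowerTempered.temperedFrobenioid R S).IsMuSaturated A K ∧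
          ∀ (b : A.base ⟶ A₀.base) (x : (ThetaTwistTowerTempered.temperedFrobenioid R S).ratFnFunctor.obj (op A₀.base)),
            Literature.AlgebraicGeometry.Frobenioids.divB (ThetaTwistTowerTempered.temperedFrobenioid R S).divisorMonoid
                (ThetaTwistTowerTempered.temperedFrobenioid R S).ratFnFunctor
                (ThetaTwistTowerTempered.temperedFrobenioid R S).divBNatTrans (op A₀.base) x = 1 →
              ∃ ζ : (ThetaTwistTowerTempered.temperedFrobenioid R S).ratFnFunctor.obj (op A.base),
                ζ ^ (K : ℕ) = pull (ThetaTwistTowerTempered.temperedFrobenioid R S).ratFnFunctor b x)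
    (hS : ∀ ⦃A B : ConnectedPart (BTemp (Compat 3 thetaShear))⦄
      (hA : IsGaloisObj ((ThetaTwistTowerTempered.temperedFrobenioid R S).base.obj A).obj)
      (hB : IsGaloisObj ((ThetaTwistTowerTempered.temperedFrobenioid R S).base.obj B).obj) (b : B ⟶ A),
      ∃ c : X.Pi, ∀ g : X.Pi, (gS B hB g).hom ≫ b = b ≫ (gS A hA (c * g * c⁻¹)).hom) :
    (BiKummerSetting.mkOfModelCanonical X (ThetaTwistTowerTempered.temperedFrobenioid R S) (monoidType_eq R S) (hP R S)
        (fun A => IsGaloisObj ((ThetaTwistTowerTempered.temperedFrobenioid R S).base.obj A).obj) gS gSs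
        (fun _ A M => ∀ (b : A.base ⟶ A₀.base) (x : (ThetaTwistTowerTempered.temperedFrobenioid R S).ratFnFunctor.obj (op A₀.base)),
          Literature.AlgebraicGeometry.Frobenioids.divB (ThetaTwistTowerTempered.temperedFrobenioid R S).divisorMonoid
              (ThetaTwistTowerTempered.temperedFrobenioid R S).ratFnFunctor
              (ThetaTwistTowerTempered.temperedFrobenioid R S).divBNatTrans (op A₀.base) x = 1 →
            ∃ ζ : (ThetaTwistTowerTempered.temperedFrobenioid R S).ratFnFunctor.obj (op A.base),
              ζ ^ (M : ℕ) = pull (ThetaTwistTowerTempered.temperedFrobenioid R S).ratFnFunctor b x)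
        A₀ hA₀ hA₀').Prop42_iii
      (fun {_ _} φ x => (ThetaTwistTowerTempered.temperedFrobenioid R S).pullFracModel φ x) ∧
    (BiKummerSetting.mkOfModelCanonical X (ThetaTwistTowerTempered.temperedFrobenioid R S) (monoidType_eq R S) (hP R S)
        (fun A => IsGaloisObj ((ThetaTwistTowerTempered.temperedFrobenioid R S).base.obj A).obj) gS gSs
        (fun _ A M => ∀ (b : A.base ⟶ A₀.base) (x : (ThetaTwistTowerTempered.temperedFrobenioid R S).ratFnFunctor.obj (op A₀.base)),
          Literature.AlgebraicGeometry.Frobenioids.divB (ThetaTwistTowerTempered.temperedFrobenioid R S).divisorMonoid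
              (ThetaTwistTowerTempered.temperedFrobenioid R S).ratFnFunctor
              (ThetaTwistTowerTempered.temperedFrobenioid R S).divBNatTrans (op A₀.base) x = 1 →
            ∃ ζ : (ThetaTwistTowerTempered.temperedFrobenioid R S).ratFnFunctor.obj (op A.base),
              ζ ^ (M : ℕ) = pull (ThetaTwistTowerTempered.temperedFrobenioid R S).ratFnFunctor b x)
        A₀ hA₀ hA₀').Prop42_iv
      (fun φ x => (ThetaTwistTowerTempered.temperedFrobenioid R S).pullFracModel φ x) := by
  refine BiKummerSetting.Prop42Sub.prop42_iii_iv_mkOfModelCanonical_rootsReading X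
    (ThetaTwistTowerTempered.temperedFrobenioid R S) (monoidType_eq R S) (hP R S) _ gS gSs A₀ hA₀ hA₀'
    (ThetaTwistTowerTempered.temperedFrobenioid R S).isDivisorial_divisorMonoid
    (fun e _ _ hab y hya hyb => ThetaTwistTowerTempered.coprimePullLaw R S e hab y hya hyb)
    (rootLaw_galois R S) ?_ hS
  intro K A' _ _
  obtain ⟨m, hm⟩ := hsatK K
  obtain ⟨Y', hY', b, hmY, hχ⟩ := exists_galoisCover_level_charTrivial A'.base m
  obtain ⟨W, δ, hW, hδ⟩ := (ThetaTwistTowerTempered.temperedFrobenioid R S).exists_isPullbackMorphism_over_baseHom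
    (ThetaTwistTowerTempered.temperedFrobenioid R S).isDivisorial_divisorMonoid A' b
  subst hW
  exact ⟨W, δ, hδ, hY', (hm W hmY hχ).1, (hm W hmY hχ).2⟩

end ThetaTwistTowerTempered

end Literature.AnabelianGeometry.EtaleTheta

end
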